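import Summits.CriticalPhenomena.PercolationContinuityZ3.Theorems.PercNearOneGluingNoHeavyLowerTailStarSetObserver
import Summits.CriticalPhenomena.PercolationContinuityZ3.Theorems.PercNearOneGluingNoHeavyLowerTailCILOwnEdgeStability
import Summits.CriticalPhenomena.PercolationContinuityZ3.Theorems.PercNearOneGluingNoHeavyLowerTailPendantStripping
import Summits.CriticalPhenomena.PercolationContinuityZ3.Theorems.PercNearOneGluingNoHeavyLowerTailCILHyperedgeReduction
import Summits.CriticalPhenomena.PercolationContinuityZ3.Theorems.PercNearOneGluingAdditiveGluingOneBond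
import HarnessLib

/-!
# `NoHeavyLowerTail` (stmt-CriticalPhenomena-4575) — two-port star sets at level `j ≤ 2`: the PORT-WITNESS case and the full observer corollary

Support file (prover `prim-gen-swap` gen 7; `--supports stmt-CriticalPhenomena-4575`).  No definitions, no named facts, no sorries.

`StarSet.setCS_twoPortStarSet_levelTwo` proves `CS_w(B, c)` for a finset `B` of two-port pendant stars with pairwise distinct ports when
the dominating relay `c` is NOT a port.  Here the champion `c` IS a port of a star `y₀ ∈ B` (seat memo R3-SEATS.md §8):

* `StarSet.setCS_twoPortStarSet_levelTwo_port` — `CS_w(B, c)` when `c` is a CHAMPION of `A` and `c ∈ {p y₀, p' y₀}` for some `y₀ ∈ B`.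
  Pivot on the pair `c–y₀` (`stub_oneBondDecomp_k15`): glued, both events are null (`c ↔ y₀`); deleted, `c` stays champion
  (`CutObserver.champion_of_erase_own_edge`), `y₀` becomes a relay-pendant on its other port `z`, which is stripped by prim-hp-6's
  `CutObserver.setCS_of_pendantMember` (the lightnesses off `y₀` are those of the deleted graph, `Hyperedge.lightness_eq_of_sameGlue`
  with glue probability `0`), leaving `CS(B ∖ y₀, c)` in the graph off `y₀` — `setCS_twoPortStarSet_levelTwo` (now `c` is off the ports).
* `StarSet.setCS_twoPortStarSet_levelTwo_champion` — both cases: `CS_w(B, c)` for every champion `c` of `A`.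
* `StarSet.cil_twoPortStars_levelTwo_champion` — **CIL_j (`j ≤ 2`, all `|A|`) at every observer `o ∉ A` whose non-relay neighbours are
  two-port pendant stars with pairwise distinct ports, witness ANY `H`-champion `q ∈ A`** (`cil_of_starStability`).
-/

noncomputable section

namespace Summit.CriticalPhenomena.PercolationContinuityZ3.Theorems

open MeasureTheory Set Literature.Probability.LatticeModels Literature.Probability.Percolation
open scoped Classical BigOperators

variable {n : ℕ}

namespace StarSet

open CutObserver KNPreFKG Hyperedge in
/-- **OES for a two-port star set when the champion is a port.**  `B`, `p`, `p'` as in `setCS_twoPortStarSet_levelTwo` (`j ≤ 2`, distinct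
ports); `c` a champion of `A` in `w` with `c = p y₀` or `c = p' y₀` for some `y₀ ∈ B`.  Then `CS_w(B, c)`.
[cite: VandenbergHaggstromKahn2005, Thm. 1.5 (p. 7) — via `setCS_of_pendantMember` and `setCS_twoPortStarSet_levelTwo`] -/
theorem setCS_twoPortStarSet_levelTwo_port (w : Sym2 (Fin n) → unitInterval) (A B : Finset (Fin n)) (p p' : Fin n → Fin n)
    (c y₀ : Fin n) (j : ℕ) (hj : j ≤ 2) (hBA : ∀ y ∈ B, y ∉ A)
    (hports : ∀ y ∈ B, p y ∈ A ∧ p' y ∈ A ∧ p y ≠ p' y)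
    (hobs : ∀ y ∈ B, ∀ u : Fin n, u ≠ y → w s(y, u) ≠ 0 → u = p y ∨ u = p' y)
    (hdis : ∀ y ∈ B, ∀ y' ∈ B, y ≠ y' → p y ≠ p y' ∧ p y ≠ p' y' ∧ p' y ≠ p y' ∧ p' y ≠ p' y')
    (hy₀ : y₀ ∈ B) (hc : c = p y₀ ∨ c = p' y₀)
    (hchamp : ∀ a ∈ A, (prodBernoulli w).real {ω : BondConfig (Fin n) | (A.filter fun z => ω ∈ openConn a z).card ≤ j} ≤
      (prodBernoulli w).real {ω : BondConfig (Fin n) | (A.filter fun z => ω ∈ openConn c z).card ≤ j}) :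
    (prodBernoulli w).real {ω : BondConfig (Fin n) | (∀ y ∈ B, ω ∉ openConn c y) ∧
        1 ≤ (A.filter fun z => ∃ y ∈ B, ω ∈ openConn y z).card ∧
        (A.filter fun z => ∃ y ∈ B, ω ∈ openConn y z).card ≤ j} ≤
      (prodBernoulli w).real {ω : BondConfig (Fin n) | (∀ y ∈ B, ω ∉ openConn c y) ∧
        (A.filter fun z => ω ∈ openConn c z).card ≤ j} := by
  haveI : ∀ u : Sym2 (Fin n) → unitInterval, IsProbabilityMeasure (prodBernoulli u) := fun u => inferInstance
  -- the other port `z` of `y₀`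
  obtain ⟨z, hzdef⟩ : ∃ z, (c = p y₀ ∧ z = p' y₀) ∨ (c = p' y₀ ∧ z = p y₀) := by
    rcases hc with h | h
    · exact ⟨p' y₀, Or.inl ⟨h, rfl⟩⟩
    · exact ⟨p y₀, Or.inr ⟨h, rfl⟩⟩
  have hcA : c ∈ A := by
    rcases hzdef with ⟨rfl, -⟩ | ⟨rfl, -⟩
    · exact (hports y₀ hy₀).1
    · exact (hports y₀ hy₀).2.1
  have hzA : z ∈ A := by
    rcases hzdef with ⟨-, rfl⟩ | ⟨-, rfl⟩
    · exact (hports y₀ hy₀).2.1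
    · exact (hports y₀ hy₀).1
  have hcz : c ≠ z := by
    rcases hzdef with ⟨rfl, rfl⟩ | ⟨rfl, rfl⟩
    · exact (hports y₀ hy₀).2.2
    · exact (hports y₀ hy₀).2.2.symm
  have hport_iff : ∀ u, (u = p y₀ ∨ u = p' y₀) ↔ (u = c ∨ u = z) := by
    intro u
    rcases hzdef with ⟨h1, h2⟩ | ⟨h1, h2⟩ <;> rw [h1, h2]
    exact or_comm
  have hy₀A : y₀ ∉ A := hBA y₀ hy₀
  have hcy : c ≠ y₀ := fun h => hy₀A (h ▸ hcA)
  have hzy : z ≠ y₀ := fun h => hy₀A (h ▸ hzA)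
  set e : Sym2 (Fin n) := s(c, y₀) with he
  have hee : s(y₀, c) = e := Sym2.eq_swap
  set LS := {ω : BondConfig (Fin n) | (∀ y ∈ B, ω ∉ openConn c y) ∧
    1 ≤ (A.filter fun z => ∃ y ∈ B, ω ∈ openConn y z).card ∧
    (A.filter fun z => ∃ y ∈ B, ω ∈ openConn y z).card ≤ j} with hLS
  set RS := {ω : BondConfig (Fin n) | (∀ y ∈ B, ω ∉ openConn c y) ∧
    (A.filter fun z => ω ∈ openConn c z).card ≤ j} with hRS
  -- both events force the pair `c–y₀` closed
  have hsub : ∀ ω : BondConfig (Fin n), (∀ y ∈ B, ω ∉ openConn c y) → e ∉ ω := by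
    intro ω h hopen
    have hadj : (openGraph ω).Adj c y₀ := by rw [openGraph, SimpleGraph.fromEdgeSet_adj]; exact ⟨hopen, hcy⟩
    exact h y₀ hy₀ hadj.reachable
  have hnull : ∀ S : Set (BondConfig (Fin n)), (∀ ω ∈ S, e ∉ ω) →
      (prodBernoulli (Function.update w e 1)).real S = 0 := by
    intro S hS
    refine le_antisymm ?_ measureReal_nonneg
    calc (prodBernoulli (Function.update w e 1)).real S
        ≤ (prodBernoulli (Function.update w e 1)).real {ω : BondConfig (Fin n) | e ∉ ω} :=
          measureReal_mono (fun ω hω => hS ω hω) (measure_ne_top _ _)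
      _ = 0 := by rw [prodBernoulli_real_setOf_notMem, Function.update_self]; simp
  have hL1 : (prodBernoulli (Function.update w e 1)).real LS = 0 := hnull LS fun ω hω => hsub ω hω.1
  have hR1 : (prodBernoulli (Function.update w e 1)).real RS = 0 := hnull RS fun ω hω => hsub ω hω.1
  have hdecL := stub_oneBondDecomp_k15 n w e LS
  have hdecR := stub_oneBondDecomp_k15 n w e RS
  rw [hL1] at hdecL
  rw [hR1] at hdecR
  set w₀ : Sym2 (Fin n) → unitInterval := Function.update w e 0 with hw₀
  have hy0 : 0 ≤ 1 - (w e : ℝ) := sub_nonneg.2 (w e).2.2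
  by_cases hy1 : (w e : ℝ) < 1
  swap
  · have hwe : (w e : ℝ) = 1 := le_antisymm (w e).2.2 (not_lt.1 hy1)
    rw [hdecL, hwe]
    have : 0 ≤ (prodBernoulli w).real RS := measureReal_nonneg
    linarith
  suffices h0 : (prodBernoulli w₀).real LS ≤ (prodBernoulli w₀).real RS by
    rw [hdecL, hdecR]
    have := mul_le_mul_of_nonneg_left h0 hy0
    linarith
  have hw₀e : w₀ e = 0 := by rw [hw₀, Function.update_self]
  have hw₀_ne : ∀ f : Sym2 (Fin n), f ≠ e → w₀ f = w f := fun f hf => by rw [hw₀, Function.update_of_ne hf]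
  -- the champion survives deleting its own pair
  have hchamp₀ := champion_of_erase_own_edge w A c y₀ j hcy hy1 hchamp
  -- in `w₀` the star `y₀` is a relay-pendant hanging on `z`
  have hobs₀ : ∀ u, u ≠ y₀ → w₀ s(y₀, u) ≠ 0 → u = c ∨ u = z := by
    intro u hu h
    by_cases huc : u = c
    · exact Or.inl huc
    rw [hw₀_ne _ (fun h' => huc (by rw [← hee] at h'; exact Sym2.congr_right.1 h'))] at h
    exact (hport_iff u).1 (hobs y₀ hy₀ u hu h)
  have hiso : ∀ u, u ≠ y₀ → u ≠ z → w₀ s(y₀, u) = 0 := by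
    intro u hu huz
    by_contra h
    rcases hobs₀ u hu h with rfl | rfl
    · rw [hee] at h; exact h hw₀e
    · exact huz rfl
  -- the weights off `y₀` and their relay lightnesses
  set w₀' : Sym2 (Fin n) → unitInterval := fun f => if f ∈ {f : Sym2 (Fin n) | y₀ ∉ f} then w₀ f else 0 with hw₀'
  have hw₀'z : ∀ u, w₀' s(y₀, u) = 0 := by
    intro u
    have : ¬ (y₀ ∉ s(y₀, u)) := fun h => h (Sym2.mem_mk_left _ _)
    simp only [hw₀', mem_setOf_eq, this, if_false]
  have hobs₀' : ∀ u, u ≠ y₀ → w₀' s(y₀, u) ≠ 0 → u = c ∨ u = z := fun u _ h => absurd (hw₀'z u) h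
  have hoff' : ∀ f : Sym2 (Fin n), y₀ ∉ f → w₀ f = w₀' f := by
    intro f hf; simp only [hw₀', mem_setOf_eq, hf, not_false_eq_true, if_true]
  have hglue' : (w₀ s(y₀, c) : ℝ) * w₀ s(y₀, z) = (w₀' s(y₀, c) : ℝ) * w₀' s(y₀, z) := by
    rw [hw₀'z c, hw₀'z z, hee, hw₀e]; simp
  have hsame : ∀ x ∈ A, (prodBernoulli w₀).real {ω : BondConfig (Fin n) | (A.filter fun a => ω ∈ openConn x a).card ≤ j} =
      (prodBernoulli w₀').real {ω : BondConfig (Fin n) | (A.filter fun a => ω ∈ openConn x a).card ≤ j} :=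
    fun x hx => lightness_eq_of_sameGlue w₀ w₀' A y₀ c z x j hy₀A hx hcy hzy hcz hobs₀ hobs₀' hoff' hglue'
  have hdom' : ∀ x ∈ A, (prodBernoulli w₀').real {ω : BondConfig (Fin n) | (A.filter fun a => ω ∈ openConn x a).card ≤ j} ≤
      (prodBernoulli w₀').real {ω : BondConfig (Fin n) | (A.filter fun a => ω ∈ openConn c a).card ≤ j} := by
    intro x hx
    rw [← hsame x hx, ← hsame c hcA]; exact hchamp₀ x hx
  -- the remaining stars, in the graph off `y₀`, with the champion off their ports
  have hw₀'_off : ∀ y u : Fin n, y ≠ y₀ → u ≠ y₀ → w₀' s(y, u) = w s(y, u) := by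
    intro y u hy hu
    have hf : y₀ ∉ s(y, u) := by
      intro h
      rcases Sym2.mem_iff.1 h with h | h
      · exact hy h.symm
      · exact hu h.symm
    rw [← hoff' _ hf, hw₀_ne _ (fun h => hf (by rw [h]; exact Sym2.mem_mk_right c y₀))]
  have hrest : (prodBernoulli w₀').real {ξ : BondConfig (Fin n) | (∀ x ∈ B.erase y₀, ξ ∉ openConn c x) ∧
        1 ≤ (A.filter fun a => ∃ x ∈ B.erase y₀, ξ ∈ openConn x a).card ∧
        (A.filter fun a => ∃ x ∈ B.erase y₀, ξ ∈ openConn x a).card ≤ j} ≤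
      (prodBernoulli w₀').real {ξ : BondConfig (Fin n) | (∀ x ∈ B.erase y₀, ξ ∉ openConn c x) ∧
        (A.filter fun a => ξ ∈ openConn c a).card ≤ j} := by
    refine setCS_twoPortStarSet_levelTwo w₀' A (B.erase y₀) p p' c j hj (fun y hy => hBA y (Finset.mem_of_mem_erase hy))
      (fun y hy => hports y (Finset.mem_of_mem_erase hy)) (fun y hy u huy hu => ?_)
      (fun y hy y' hy' hne => hdis y (Finset.mem_of_mem_erase hy) y' (Finset.mem_of_mem_erase hy') hne) hcA
      (fun y hy => ?_) (fun y hy => ?_)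
    · have hyy₀ : y ≠ y₀ := Finset.ne_of_mem_erase hy
      have huy₀ : u ≠ y₀ := by
        intro h
        apply hu
        rw [h, Sym2.eq_swap]
        exact hw₀'z y
      rw [hw₀'_off y u hyy₀ huy₀] at hu
      exact hobs y (Finset.mem_of_mem_erase hy) u huy hu
    · have hd := hdis y₀ hy₀ y (Finset.mem_of_mem_erase hy) (Finset.ne_of_mem_erase hy).symm
      rcases hzdef with ⟨h1, -⟩ | ⟨h1, -⟩ <;> rw [h1]
      · exact ⟨hd.1, hd.2.1⟩
      · exact ⟨hd.2.2.1, hd.2.2.2⟩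
    · have hps := hports y (Finset.mem_of_mem_erase hy)
      exact ⟨hdom' _ hps.1, hdom' _ hps.2.1⟩
  have hdomz : (prodBernoulli w₀').real {ω : BondConfig (Fin n) | (A.filter fun a => ω ∈ openConn z a).card ≤ j} ≤
      (prodBernoulli w₀').real {ω : BondConfig (Fin n) | (A.filter fun a => ω ∈ openConn c a).card ≤ j} := hdom' z hzA
  exact setCS_of_pendantMember w₀ A B c y₀ z j hy₀ hy₀A hzy hcy hiso hdomz hrest

/-- **OES for a two-port star set at level `j ≤ 2`, champion witness (port or not).**  `B`, `p`, `p'` as in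
`setCS_twoPortStarSet_levelTwo`; `c` a champion of `A`.  Then `CS_w(B, c)`. [cite: VandenbergHaggstromKahn2005, Thm. 1.5 (p. 7)] -/
theorem setCS_twoPortStarSet_levelTwo_champion (w : Sym2 (Fin n) → unitInterval) (A B : Finset (Fin n))
    (p p' : Fin n → Fin n) (c : Fin n) (j : ℕ) (hj : j ≤ 2) (hBA : ∀ y ∈ B, y ∉ A)
    (hports : ∀ y ∈ B, p y ∈ A ∧ p' y ∈ A ∧ p y ≠ p' y)
    (hobs : ∀ y ∈ B, ∀ u : Fin n, u ≠ y → w s(y, u) ≠ 0 → u = p y ∨ u = p' y)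
    (hdis : ∀ y ∈ B, ∀ y' ∈ B, y ≠ y' → p y ≠ p y' ∧ p y ≠ p' y' ∧ p' y ≠ p y' ∧ p' y ≠ p' y')
    (hcA : c ∈ A)
    (hchamp : ∀ a ∈ A, (prodBernoulli w).real {ω : BondConfig (Fin n) | (A.filter fun z => ω ∈ openConn a z).card ≤ j} ≤
      (prodBernoulli w).real {ω : BondConfig (Fin n) | (A.filter fun z => ω ∈ openConn c z).card ≤ j}) :
    (prodBernoulli w).real {ω : BondConfig (Fin n) | (∀ y ∈ B, ω ∉ openConn c y) ∧
        1 ≤ (A.filter fun z => ∃ y ∈ B, ω ∈ openConn y z).card ∧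
        (A.filter fun z => ∃ y ∈ B, ω ∈ openConn y z).card ≤ j} ≤
      (prodBernoulli w).real {ω : BondConfig (Fin n) | (∀ y ∈ B, ω ∉ openConn c y) ∧
        (A.filter fun z => ω ∈ openConn c z).card ≤ j} := by
  by_cases hcp : ∀ y ∈ B, c ≠ p y ∧ c ≠ p' y
  · exact setCS_twoPortStarSet_levelTwo w A B p p' c j hj hBA hports hobs hdis hcA hcp
      (fun y hy => ⟨hchamp _ (hports y hy).1, hchamp _ (hports y hy).2.1⟩)
  · push Not at hcp
    obtain ⟨y₀, hy₀, hc⟩ := hcp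
    have hc' : c = p y₀ ∨ c = p' y₀ := by
      by_cases h : c = p y₀
      · exact Or.inl h
      · exact Or.inr (hc h)
    exact setCS_twoPortStarSet_levelTwo_port w A B p p' c y₀ j hj hBA hports hobs hdis hy₀ hc' hchamp

open CutObserver in
/-- **CIL at level `j ≤ 2` for an observer whose Steiner neighbours are two-port pendant stars with pairwise distinct ports — any
`H`-champion as witness.**  `o ∉ A`; every positive-weight non-relay neighbour `y` of `o` has, off `o`, positive pairs only to two
distinct relays `p y ≠ p' y`; ports of distinct such neighbours are distinct; `q ∈ A` dominates every relay in `H`-lightness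
(`H = G − o`).  Then `μ(1 ≤ |π(o)| ≤ j) ≤ μ(|π(q)| ≤ j)` — any number of such neighbours, any relay neighbours, all `|A|`.
[cite: VandenbergHaggstromKahn2005, Thm. 1.5 (p. 7); KozmaNitzan2024, Thm. 4 (pp. 13–14) — star transfer `cil_of_starStability`] -/
theorem cil_twoPortStars_levelTwo_champion (w : Sym2 (Fin n) → unitInterval) (A : Finset (Fin n)) (o q : Fin n)
    (p p' : Fin n → Fin n) (j : ℕ) (hj : j ≤ 2) (hoA : o ∉ A) (hqA : q ∈ A)
    (hnbrs : ∀ y : Fin n, y ≠ o → y ∉ A → w s(o, y) ≠ 0 →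
      p y ∈ A ∧ p' y ∈ A ∧ p y ≠ p' y ∧ ∀ u : Fin n, u ≠ y → u ≠ o → w s(y, u) ≠ 0 → u = p y ∨ u = p' y)
    (hdis : ∀ y y' : Fin n, y ≠ o → y' ≠ o → y ∉ A → y' ∉ A → w s(o, y) ≠ 0 → w s(o, y') ≠ 0 → y ≠ y' →
      p y ≠ p y' ∧ p y ≠ p' y' ∧ p' y ≠ p y' ∧ p' y ≠ p' y')
    (hchamp : ∀ a ∈ A,
      (prodBernoulli w).real {ω : BondConfig (Fin n) |
          (A.filter fun z => (openGraph (ω ∩ {e | o ∉ e})).Reachable a z).card ≤ j} ≤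
        (prodBernoulli w).real {ω : BondConfig (Fin n) |
          (A.filter fun z => (openGraph (ω ∩ {e | o ∉ e})).Reachable q z).card ≤ j}) :
    (prodBernoulli w).real {ω : BondConfig (Fin n) |
        1 ≤ (A.filter fun x => ω ∈ openConn o x).card ∧ (A.filter fun x => ω ∈ openConn o x).card ≤ j} ≤
      (prodBernoulli w).real {ω : BondConfig (Fin n) | (A.filter fun x => ω ∈ openConn q x).card ≤ j} := by
  have hqo : q ≠ o := fun h => hoA (h ▸ hqA)
  refine cil_of_starStability w A o q j hoA hqo fun B hBne hB => ?_
  set u : Sym2 (Fin n) → unitInterval := fun e => if e ∈ {e : Sym2 (Fin n) | o ∉ e} then w e else 0 with hu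
  have hmem : ∀ y ∈ B, y ≠ o ∧ y ∉ A ∧ w s(o, y) ≠ 0 := by
    intro y hy
    obtain ⟨hyo, hwy, hlt⟩ := hB y hy
    refine ⟨hyo, fun hyA => ?_, hwy⟩
    exact absurd (hchamp y hyA) (not_le.2 hlt)
  have e1 : ∀ x : Fin n, {ω : BondConfig (Fin n) |
        (A.filter fun z => (openGraph (ω ∩ {e | o ∉ e})).Reachable x z).card ≤ j} =
      {ω : BondConfig (Fin n) | ω ∩ {e | o ∉ e} ∈
        {ξ : BondConfig (Fin n) | (A.filter fun z => ξ ∈ openConn x z).card ≤ j}} := by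
    intro x; ext ω; simp only [mem_setOf_eq, filter_avoid_eq]
  have hdomH : ∀ x ∈ A, (prodBernoulli u).real {ξ : BondConfig (Fin n) | (A.filter fun z => ξ ∈ openConn x z).card ≤ j} ≤
      (prodBernoulli u).real {ξ : BondConfig (Fin n) | (A.filter fun z => ξ ∈ openConn q z).card ≤ j} := by
    intro x hx
    have h := hchamp x hx
    rw [e1 x, e1 q, measureReal_preimage_avoid, measureReal_preimage_avoid] at h
    exact h
  have e2 : {ω : BondConfig (Fin n) |
        (∀ y ∈ B, ¬ (openGraph (ω ∩ {e | o ∉ e})).Reachable q y) ∧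
          1 ≤ (A.filter fun z => ∃ y ∈ B, (openGraph (ω ∩ {e | o ∉ e})).Reachable y z).card ∧
          (A.filter fun z => ∃ y ∈ B, (openGraph (ω ∩ {e | o ∉ e})).Reachable y z).card ≤ j} =
      {ω : BondConfig (Fin n) | ω ∩ {e | o ∉ e} ∈
        {ξ : BondConfig (Fin n) | (∀ x ∈ B, ξ ∉ openConn q x) ∧
          1 ≤ (A.filter fun z => ∃ x ∈ B, ξ ∈ openConn x z).card ∧
          (A.filter fun z => ∃ x ∈ B, ξ ∈ openConn x z).card ≤ j}} := by
    ext ω; simp only [mem_setOf_eq, filter_avoid_exists_eq]; exact Iff.rfl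
  have e3 : {ω : BondConfig (Fin n) |
        (∀ y ∈ B, ¬ (openGraph (ω ∩ {e | o ∉ e})).Reachable q y) ∧
          (A.filter fun z => (openGraph (ω ∩ {e | o ∉ e})).Reachable q z).card ≤ j} =
      {ω : BondConfig (Fin n) | ω ∩ {e | o ∉ e} ∈
        {ξ : BondConfig (Fin n) | (∀ x ∈ B, ξ ∉ openConn q x) ∧
          (A.filter fun z => ξ ∈ openConn q z).card ≤ j}} := by
    ext ω; simp only [mem_setOf_eq, filter_avoid_eq]; exact Iff.rfl
  rw [e2, e3, measureReal_preimage_avoid, measureReal_preimage_avoid]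
  have hu_oy : ∀ y v : Fin n, v = o → u s(y, v) = 0 := by
    intro y v hv
    simp only [hu, mem_setOf_eq]
    rw [if_neg (fun h => h (hv ▸ Sym2.mem_mk_right y v))]
  have hu_off : ∀ y v : Fin n, y ≠ o → v ≠ o → u s(y, v) = w s(y, v) := by
    intro y v hy hv
    simp only [hu, mem_setOf_eq]
    rw [if_pos]
    intro h
    rcases Sym2.mem_iff.1 h with h | h
    · exact hy h.symm
    · exact hv h.symm
  refine setCS_twoPortStarSet_levelTwo_champion u A B p p' q j hj (fun y hy => (hmem y hy).2.1)
    (fun y hy => ?_) (fun y hy v hvy hv => ?_) (fun y hy y' hy' hne => ?_) hqA hdomH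
  · obtain ⟨hyo, hyA, hwy⟩ := hmem y hy
    obtain ⟨h1, h2, h3, -⟩ := hnbrs y hyo hyA hwy
    exact ⟨h1, h2, h3⟩
  · obtain ⟨hyo, hyA, hwy⟩ := hmem y hy
    have hvo : v ≠ o := fun hvo => hv (hu_oy y v hvo)
    rw [hu_off y v hyo hvo] at hv
    exact (hnbrs y hyo hyA hwy).2.2.2 v hvy hvo hv
  · obtain ⟨hyo, hyA, hwy⟩ := hmem y hy
    obtain ⟨hyo', hyA', hwy'⟩ := hmem y' hy'
    exact hdis y y' hyo hyo' hyA hyA' hwy hwy' hne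

end StarSet

end Summit.CriticalPhenomena.PercolationContinuityZ3.Theorems

end
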